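import Literature.AlgebraicGeometry.Resolution.MacaulayficationKawasakiStepFiveA
import HarnessLib

/-!
# Kawasaki's interwoven induction, Step 7 (Kawasaki 2000, proof of Thm. 3.1)

Topic: `Literature/AlgebraicGeometry/Resolution`. Brick of the proof of the named facts
`KawasakiMacaulayfication` / `CesnaviciusMacaulayfication`; sequel of
`MacaulayficationKawasakiStepFiveA.lean`. Step 7 of the printed proof of Kawasaki 2000, Thm. 3.1
(pp. 2527–2528): **if `j > i`, then `(C_{i+1,j})` implies `(D_ij)`.**

* `IsPStandard.kawasaki318` — the auxiliary equality **(3.1.8)**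
  `[(Y)M + xᵢq_{i+1}⋯qⱼM] : y_u = xᵢ·{[(Y)M + q_{i+1}⋯qⱼM] : y_u} + (Y)M : y_u`
  ("because `xᵢ,…,x_d` is a `d`-sequence on `M/(y₁,…,y_u)M`");
* `IsPStandard.kawasakiD31_of_succ` — `(D_ij)`: with `xᵢa` on the left, write
  `y_uxᵢa = xᵢb + b'`, bound `y_ua - b ∈ [(Y)M + q_{i+1}²q_{i+2}⋯qⱼM] : xᵢ` by `(C_{i+1,j})`, use
  (3.1.8), and remove `(Y)M : y_u ∩ xᵢM` by (2.9.2) (`(Y)M : y_uxᵢ = (Y)M : xᵢ`).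

Everything is proved; no named fact is introduced.

## References

* [Kawasaki2000] T. Kawasaki, *On Macaulayfication of Noetherian schemes*, Trans. AMS 352 (2000)
  2517–2552, proof of Thm. 3.1, Step 7 (pp. 2527–2528).
-/

namespace Literature.AlgebraicGeometry.Resolution

open Ideal Submodule Module IsLocalRing
open scoped Pointwise

universe u v

variable {R : Type u} [CommRing R] [IsLocalRing R] [IsNoetherianRing R]
variable {M : Type v} [AddCommGroup M] [Module R M] [Module.Finite R M]

namespace IsPStandard

variable {xs : List R}

/-- **(3.1.8)** (Kawasaki 2000, proof of Thm. 3.1, Step 7): for a subsystem of parameters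
`Y, y_u` of `M/qᵢ₊₁M` and any ideal `W ⊆ qᵢ₊₁` (in print `W = q_{i+1}⋯qⱼ`),
`[(Y)M + xᵢ₊₁WM] : y_u = xᵢ₊₁·{[(Y)M + WM] : y_u} + (Y)M : y_u`. With `a` on the left,
`y_ua = xᵢb + c`; `b ∈ (Y,y_u)M : xᵢ ∩ qᵢM ⊆ (Y,y_u)M` (Lemma 2.2), so `b = y_ua' + c'`; then
`a' ∈ [(Y)M + WM] : y_u` and `a - xᵢa' ∈ (Y)M : y_u`. [cite: Kawasaki2000, Thm. 3.1, Step 7 (3.1.8)] -/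
theorem kawasaki318 (hx : IsPStandard M xs) {i : ℕ} (hi : i < xs.length) {Y : List R} {yu : R}
    (hys : IsSecantSequence M (xs.drop i ++ (Y ++ [yu]))) (hym : ∀ y ∈ Y ++ [yu], y ∈ maximalIdeal R)
    {W : Ideal R} (hW : W ≤ tailIdeal xs i) :
    colonBy (ofList Y • ⊤ ⊔ span {xs[i]} • (W • ⊤) : Submodule R M) yu =
      span {xs[i]} • colonBy (ofList Y • ⊤ ⊔ W • ⊤ : Submodule R M) yu ⊔
        colonBy (ofList Y • ⊤ : Submodule R M) yu := by
  refine le_antisymm ?_ (sup_le (ideal_smul_colonBy_sup_le _ _ _ _) (colonBy_mono le_sup_left _))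
  intro a ha
  rw [mem_colonBy] at ha
  obtain ⟨c, hc, t, ht, e1⟩ := Submodule.mem_sup.mp ha
  obtain ⟨b, hb, rfl⟩ := mem_span_singleton_smul_iff.mp ht
  -- `b ∈ (Y, y_u)M : xᵢ ∩ qᵢM ⊆ (Y, y_u)M` by Lemma 2.2
  have hbq : b ∈ (ofList (Y ++ [yu]) • ⊤ ⊔ tailIdeal xs i • ⊤ : Submodule R M) :=
    Submodule.mem_sup_right ((Submodule.smul_mono_left hW) hb)
  have hxb : xs[i] • b ∈ (ofList ((Y ++ [yu]) ++ seg xs i i) • ⊤ : Submodule R M) := by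
    rw [seg_self, List.append_nil, ofList_append_smul]
    have e : xs[i] • b = yu • a - c := by rw [← e1]; abel
    rw [e]
    exact Submodule.sub_mem _ (Submodule.mem_sup_right (smul_mem_ofList_smul_top (by simp) a))
      (Submodule.mem_sup_left hc)
  have hb' := hx.mem_sup_seg_of_smul_mem hys hym le_rfl hi hbq hxb
  rw [seg_self, List.append_nil, ofList_append_smul, ofList_singleton] at hb'
  obtain ⟨c', hc', s, hs, e2⟩ := Submodule.mem_sup.mp hb'
  obtain ⟨a', -, rfl⟩ := mem_span_singleton_smul_iff.mp hs
  -- `a' ∈ [(Y)M + WM] : y_u` and `a - xᵢa' ∈ (Y)M : y_u`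
  have ha' : a' ∈ colonBy (ofList Y • ⊤ ⊔ W • ⊤ : Submodule R M) yu := by
    rw [mem_colonBy]
    have e : yu • a' = b - c' := by rw [← e2]; abel
    rw [e]
    exact Submodule.sub_mem _ (Submodule.mem_sup_right hb) (Submodule.mem_sup_left hc')
  have hrest : a - xs[i] • a' ∈ colonBy (ofList Y • ⊤ : Submodule R M) yu := by
    rw [mem_colonBy]
    have e : yu • (a - xs[i] • a') = c + xs[i] • c' := by
      have h2 : xs[i] • b = xs[i] • c' + xs[i] • (yu • a') := by rw [← e2, smul_add]
      rw [smul_sub, smul_comm yu xs[i] a', ← e1, h2]; abel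
    rw [e]
    exact Submodule.add_mem _ hc (Submodule.smul_mem _ _ hc')
  have e3 : a = xs[i] • a' + (a - xs[i] • a') := by abel
  rw [e3]
  exact Submodule.add_mem _ (Submodule.mem_sup_left (Submodule.smul_mem_smul
    (Ideal.mem_span_singleton_self _) ha')) (Submodule.mem_sup_right hrest)

/-- **(2.9.2) for `y₁,…,y_u, xᵢ` on `M/q_{i+1}M`** (Steps 6, 7): `(Y)M : y_uxᵢ₊₁ = (Y)M : xᵢ₊₁`
for a subsystem of parameters `Y, y_u` of `M/qᵢ₊₁M`. [cite: Kawasaki2000, Thm. 2.9] -/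
theorem colonBy_mul_getElem_eq (hx : IsPStandard M xs) {i : ℕ} (hi : i < xs.length) {Y : List R}
    {yu : R} (hys : IsSecantSequence M (xs.drop i ++ (Y ++ [yu])))
    (hym : ∀ y ∈ Y ++ [yu], y ∈ maximalIdeal R) :
    colonBy (ofList Y • ⊤ : Submodule R M) (yu * xs[i]) = colonBy (ofList Y • ⊤ : Submodule R M) xs[i] := by
  classical
  have hS := hx.mem_maximalIdeal_drop_append i hym
  have hysE : IsSecantSequence M (xs.drop (i + 1) ++ ((Y ++ [yu]) ++ [xs[i]])) := by
    refine hys.of_perm ?_ hS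
    rw [List.drop_eq_getElem_cons hi]
    exact List.perm_iff_count.mpr fun r => by
      simp only [List.count_append, List.count_cons, List.count_nil]; omega
  have hymE : ∀ y ∈ (Y ++ [yu]) ++ [xs[i]], y ∈ maximalIdeal R := by
    intro y hy
    rcases List.mem_append.mp hy with hy | hy
    · exact hym y hy
    · rw [List.mem_singleton] at hy; rw [hy]
      exact hx.mem_maximalIdeal _ (List.getElem_mem hi)
  have key := hx.colonBy_mul_eq_colonBy_nil (X₀ := xs.take (i + 1)) (D := xs.drop (i + 1))
    (List.take_append_drop _ xs).symm hysE hymE (Y := Y ++ [yu]) (yu := xs[i]) rfl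
    (Or.inr (hx.kills (xs.take i) xs[i] (xs.drop (i + 1))
      (by rw [← List.drop_eq_getElem_cons hi, List.take_append_drop]))) (m := Y.length) (by simp)
  have e5 : ((Y ++ [yu]) ++ [xs[i]]).take Y.length = Y := by
    rw [List.append_assoc, List.take_left]
  have e6 : ((Y ++ [yu]) ++ [xs[i]])[Y.length]'(by simp) = yu := by
    simp [List.getElem_append_right]
  rwa [e5, e6] at key

/-- **Step 7 of Kawasaki 2000, Thm. 3.1: if `j > i`, then `(C_{i+1,j})` implies `(D_ij)`.**
[cite: Kawasaki2000, Thm. 3.1, Step 7] -/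
theorem kawasakiD31_of_succ (hx : IsPStandard M xs) {i j : ℕ} (hij : i + 1 ≤ j)
    (hC1 : Kawasaki.C31 M xs (i + 1) j) : Kawasaki.D31 M xs i j := by
  classical
  intro hi Y yu hys hym
  have hS := hx.mem_maximalIdeal_drop_append i hym
  -- notation: `W = q_{i+1}⋯qⱼ`, `qᵢ⋯qⱼ = qᵢ·W ⊆ (xᵢ)W + q_{i+1}W`
  have hW : prodPow xs (fun _ : ℕ => 1) (i + 1) j ≤ tailIdeal xs (i + 1) :=
    prodPow_le_tailIdeal (Finset.mem_Icc.mpr ⟨le_rfl, hij⟩) Nat.one_pos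
  have hQ1 : prodPow xs (fun _ => 1) i j ≤
      span {xs[i]} * prodPow xs (fun _ => 1) (i + 1) j ⊔
        tailIdeal xs (i + 1) * prodPow xs (fun _ => 1) (i + 1) j := by
    rw [prodPow_eq_mul _ (by omega : i ≤ j), pow_one, ← Ideal.sup_mul]
    exact Ideal.mul_mono_left (tailIdeal_eq_span_sup hi).le
  -- the subsystem of parameters `Y, xᵢ` (last element `xᵢ`) of `M/q_{i+1}M`, exponent `2` at `i+1`
  have hysC : IsSecantSequence M (xs.drop (i + 1) ++ (Y ++ [xs[i]])) := by
    refine hys.of_subperm ⟨xs[i] :: (xs.drop (i + 1) ++ Y), ?_, ?_⟩ hS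
    · exact List.perm_iff_count.mpr fun r => by
        simp only [List.count_append, List.count_cons, List.count_nil]; omega
    · rw [List.drop_eq_getElem_cons hi, List.cons_append]
      exact ((List.Sublist.refl _).append (List.sublist_append_left Y [yu])).cons_cons xs[i]
  have hymC : ∀ y ∈ Y ++ [xs[i]], y ∈ maximalIdeal R := by
    intro y hy
    rcases List.mem_append.mp hy with hy | hy
    · exact hym y (List.mem_append_left _ hy)
    · rw [List.mem_singleton] at hy; rw [hy]
      exact hx.mem_maximalIdeal _ (List.getElem_mem hi)
  set n₂ : ℕ → ℕ := Function.update (fun _ => 1) (i + 1) 2 with hn₂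
  have hn₂pos : Kawasaki.PosOn n₂ (i + 1) j := fun t _ => by
    rcases eq_or_ne t (i + 1) with rfl | ht
    · rw [hn₂, Function.update_self]; exact Nat.succ_pos 1
    · rw [hn₂, Function.update_of_ne ht]; exact Nat.one_pos
  have hW2 : prodPow xs n₂ (i + 1) j = tailIdeal xs (i + 1) * prodPow xs (fun _ => 1) (i + 1) j := by
    rw [prodPow_eq_mul _ hij, prodPow_eq_mul (fun _ : ℕ => 1) hij, hn₂, Function.update_self, pow_two,
      pow_one, mul_assoc, prodPow_congr (n' := fun _ => 1) (fun t ht => Function.update_of_ne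
        (by rw [Finset.mem_Icc] at ht; omega) _ _)]
  have hupd : prodPow xs (Function.update n₂ (i + 1) (n₂ (i + 1) - 1)) (i + 1) j =
      prodPow xs (fun _ => 1) (i + 1) j := by
    refine prodPow_congr fun t _ => ?_
    rcases eq_or_ne t (i + 1) with rfl | ht
    · rw [Function.update_self, hn₂, Function.update_self]
    · rw [Function.update_of_ne ht, hn₂, Function.update_of_ne ht]
  -- start: an element `xᵢa` of the left-hand side
  intro m hm
  obtain ⟨hm1, hm2⟩ := Submodule.mem_inf.mp hm
  obtain ⟨a, -, rfl⟩ := mem_span_singleton_smul_iff.mp hm2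
  rw [mem_colonBy] at hm1
  -- `y_uxᵢa = c + xᵢb + b''` with `c ∈ (Y)M`, `b ∈ WM`, `b'' ∈ q_{i+1}WM`
  have hm1' : yu • (xs[i] • a) ∈ (ofList Y • ⊤ ⊔ (tailIdeal xs (i + 1) * prodPow xs (fun _ => 1)
      (i + 1) j) • ⊤ : Submodule R M) ⊔ span {xs[i]} • (prodPow xs (fun _ => 1) (i + 1) j • ⊤) := by
    have hle : (ofList Y • ⊤ ⊔ prodPow xs (fun _ => 1) i j • ⊤ : Submodule R M) ≤
        (ofList Y • ⊤ ⊔ (tailIdeal xs (i + 1) * prodPow xs (fun _ => 1) (i + 1) j) • ⊤) ⊔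
          span {xs[i]} • (prodPow xs (fun _ => 1) (i + 1) j • ⊤) := by
      refine sup_le (le_sup_left.trans le_sup_left) ((Submodule.smul_mono_left hQ1).trans ?_)
      rw [Submodule.sup_smul, Submodule.mul_smul]
      exact sup_le le_sup_right (le_sup_left.trans' le_sup_right)
    exact hle hm1
  obtain ⟨b', hb', t, ht, e1⟩ := Submodule.mem_sup.mp hm1'
  obtain ⟨b, hb, rfl⟩ := mem_span_singleton_smul_iff.mp ht
  -- `y_ua - b ∈ [(Y)M + q_{i+1}WM] : xᵢ ⊆ (Y)M : xᵢ + WM` by `(C_{i+1,j})`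
  have hmem : yu • a - b ∈ colonBy (ofList Y • ⊤ ⊔ prodPow xs n₂ (i + 1) j • ⊤ : Submodule R M)
      xs[i] := by
    rw [mem_colonBy, smul_sub, smul_comm xs[i] yu a]
    have e : yu • xs[i] • a - xs[i] • b = b' := by rw [← e1, add_sub_cancel_right]
    rw [e, hW2]
    exact hb'
  have hC := hC1 n₂ hn₂pos Y xs[i] hysC hymC hmem
  rw [hupd] at hC
  -- hence `y_uxᵢa ∈ (Y)M + xᵢWM`, i.e. `xᵢa ∈ [(Y)M + xᵢWM] : y_u`, and (3.1.8) applies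
  have h318 := hx.kawasaki318 hi hys hym (hW.trans (tailIdeal_antitone xs (Nat.le_succ i)))
  have hxa : xs[i] • a ∈ colonBy (ofList Y • ⊤ ⊔ span {xs[i]} • (prodPow xs (fun _ => 1) (i + 1) j •
      ⊤) : Submodule R M) yu := by
    rw [mem_colonBy, smul_comm yu xs[i] a]
    obtain ⟨z, hz, w, hw, e2⟩ := Submodule.mem_sup.mp hC
    rw [mem_colonBy] at hz
    have e : xs[i] • (yu • a) = xs[i] • z + xs[i] • (w + b) := by
      rw [← smul_add, ← add_assoc, e2, sub_add_cancel]
    rw [e]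
    exact Submodule.add_mem _ (Submodule.mem_sup_left hz) (Submodule.mem_sup_right
      (Submodule.smul_mem_smul (Ideal.mem_span_singleton_self _) (Submodule.add_mem _ hw hb)))
  rw [h318] at hxa
  obtain ⟨p, hp, r, hr, e3⟩ := Submodule.mem_sup.mp hxa
  -- `r = xᵢa - p ∈ (Y)M : y_u ∩ xᵢM = xᵢ·((Y)M : y_uxᵢ) = xᵢ·((Y)M : xᵢ) ⊆ (Y)M` by (2.9.2)
  obtain ⟨p', hp', rfl⟩ := mem_span_singleton_smul_iff.mp hp
  have hr' : r = xs[i] • (a - p') := by rw [smul_sub, ← e3]; abel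
  have hq : a - p' ∈ colonBy (ofList Y • ⊤ : Submodule R M) (yu * xs[i]) := by
    rw [mem_colonBy] at hr
    rw [mem_colonBy, mul_smul, ← hr']
    exact hr
  rw [hx.colonBy_mul_getElem_eq hi hys hym, mem_colonBy, ← hr'] at hq
  rw [← e3]
  exact Submodule.add_mem _ (Submodule.mem_sup_left (Submodule.smul_mem_smul
    (Ideal.mem_span_singleton_self _) hp')) (Submodule.mem_sup_right hq)

end IsPStandard

end Literature.AlgebraicGeometry.Resolution
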